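import Mathlib
import Literature.MathematicalPhysics.QuantumLattice.WilsonDiracAP

/-!
# Crude entry bound for the closed-form block Hessian on the corner box
(helper for crux stmt-QuantumFields-9734, line `Sketch`, stub `stub_cornerEntryBound`)

What.  For block momenta `θ ∈ (0, π)⁴` in the corner box `min (θ_μ, π − θ_μ) < 1/20` (all `μ`),
write `C_κ = cos θ_κ`, `S2_κ = 1 − C_κ² = sin² θ_κ`, `sg t κ = (−1)^{t κ}` for shifts
`t : Fin 4 → ZMod 2`, `A σ = Σ_κ (1 − sg σ κ · C_κ)`, `hh σ = (A σ)² + Σ_κ S2_κ`,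
`W s = Σ_κ sg s κ · S2_κ`, and let `T σ s μ ν`, `Hc s μ ν` be the bubble numerator and the
closed-form block-Hessian entry of the skeleton (tadpole sum `Σ_σ 2 (S2_μ − A σ · sg σ μ C_μ) / hh σ`
on the diagonal plus bubble sum `Σ_σ 2 T σ s μ ν / (hh σ · hh (σ + s))`).  Then for every shift `s`
with `s μ = 1` (and `s ν = 1`) the entry is crudely bounded: `|Hc s μ ν| ≤ 256`
(`stub_cornerEntryBound`; numerically the supremum is `≈ 1.31`).  This feeds the Gershgorin step of
the corner block margin `stub_blockMargin3b`.

How.  Elementary real inequalities, organised around a dichotomy that needs no identification of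
the aligned shift: every term `1 − sg σ κ C_κ` is either `1 − |C_κ| ∈ [0, S2_κ]` or
`1 + |C_κ| ≥ 1`, so for every shift either `A σ ≥ 1` or `0 ≤ A σ ≤ Σ := Σ_κ S2_κ`
(`CornerEntry.dichotomy`); and since `s μ = 1` flips the `μ`-sign, `A σ + A (σ + s) ≥ 2`
(`CornerEntry.two_le_sum_add`), so the two denominators `hh σ, hh (σ + s) ≥ Σ` are never both
small.  In the corner box `S2_κ = sin² θ_κ ≤ 1/400` (`CornerEntry.sin_sq_le`).  With these,
`|2 (S2_μ − A σ c) / hh σ| ≤ 4` (`CornerEntry.tad_core`) and `|2 T / (hh σ hh (σ+s))| ≤ 10`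
(`CornerEntry.bub_core`, a three-case estimate `|T| ≤ 5 hh σ hh (σ+s)`), and summing over the
`16` shifts gives `64 + 160 ≤ 256`.

Sources.  Folklore (free Wilson-fermion one-loop block algebra; Montvay–Münster,
*Quantum Fields on a Lattice* §4.2 for the setting).  Pure theorem file (no `def`s); pattern:
sibling `…StubCornerCounting`.
-/

noncomputable section

open scoped BigOperators Classical Matrix ComplexConjugate
open Finset
open Literature.MathematicalPhysics.QuantumLattice Literature.MathematicalPhysics.QuantumFieldTheory
  Literature.Probability.LatticeModels

namespace Summit.QuantumFields.QCD.Cruxes.CriticalLineDiamagnetism.ChessboardCellGain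

namespace CornerEntry

/-! ### Scalar facts -/

/-- In the corner box `min (x, π − x) < 1/20`, `0 < x < π`: `0 ≤ 1 − cos² x = sin² x ≤ 1/400`. -/
theorem sin_sq_le (x : ℝ) (h0 : 0 < x) (hπ : x < Real.pi)
    (hm : min x (Real.pi - x) < 1 / 20) :
    0 ≤ 1 - Real.cos x ^ 2 ∧ 1 - Real.cos x ^ 2 ≤ 1 / 400 := by
  rw [← Real.sin_sq]
  have hs0 : 0 ≤ Real.sin x := Real.sin_nonneg_of_nonneg_of_le_pi h0.le hπ.le
  have hs1 : Real.sin x ≤ 1 / 20 := by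
    rcases min_lt_iff.mp hm with h | h
    · exact (Real.sin_le h0.le).trans h.le
    · rw [← Real.sin_pi_sub]
      exact (Real.sin_le (by linarith)).trans h.le
  exact ⟨sq_nonneg _, by nlinarith⟩

/-- Adding `1` in `ZMod 2` flips the sign `(−1)^{val}`. -/
theorem neg_one_pow_val_add_one (a : ZMod 2) :
    (-1 : ℝ) ^ (a + 1).val = -(-1 : ℝ) ^ a.val := by
  have h : ∀ b : ZMod 2, b = 0 ∨ b = 1 := by decide
  rcases h a with rfl | rfl
  · have e1 : ((0 : ZMod 2) + 1).val = 1 := by decide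
    have e2 : (0 : ZMod 2).val = 0 := by decide
    rw [e1, e2]
    norm_num
  · have e1 : ((1 : ZMod 2) + 1).val = 0 := by decide
    have e2 : (1 : ZMod 2).val = 1 := by decide
    rw [e1, e2]
    norm_num

/-- A signed cosine term is nonnegative: `0 ≤ 1 − e c` for `|e| = 1`, `|c| ≤ 1`. -/
theorem term_nonneg {e c : ℝ} (he : |e| = 1) (hc : |c| ≤ 1) : 0 ≤ 1 - e * c := by
  have h1 : e * c ≤ |e * c| := le_abs_self _
  rw [abs_mul, he, one_mul] at h1
  linarith

/-- The dichotomy: `A = Σ_κ (1 − e_κ c_κ)` is either `≥ 1` (some sign is wrong) or lies in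
`[0, Σ_κ (1 − c_κ²)]` (all signs aligned, `1 − |c| ≤ 1 − c²`). -/
theorem dichotomy (c e q : Fin 4 → ℝ) (hc : ∀ κ, |c κ| ≤ 1) (he : ∀ κ, |e κ| = 1)
    (hq : ∀ κ, q κ = 1 - c κ ^ 2) :
    1 ≤ ∑ κ, (1 - e κ * c κ) ∨
      (0 ≤ ∑ κ, (1 - e κ * c κ) ∧ ∑ κ, (1 - e κ * c κ) ≤ ∑ κ, q κ) := by
  have hnn : ∀ κ, 0 ≤ 1 - e κ * c κ := fun κ => term_nonneg (he κ) (hc κ)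
  by_cases H : ∃ κ, e κ * c κ ≤ 0
  · left
    obtain ⟨κ, hκ⟩ := H
    calc (1 : ℝ) ≤ 1 - e κ * c κ := by linarith
      _ ≤ ∑ κ, (1 - e κ * c κ) :=
        Finset.single_le_sum (f := fun κ => 1 - e κ * c κ) (fun i _ => hnn i)
          (Finset.mem_univ κ)
  · right
    push Not at H
    refine ⟨Finset.sum_nonneg fun i _ => hnn i, Finset.sum_le_sum fun κ _ => ?_⟩
    have h1 : e κ * c κ = |c κ| := by
      rw [← abs_of_pos (H κ), abs_mul, he, one_mul]
    have h2 : c κ ^ 2 ≤ |c κ| := by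
      rw [← sq_abs]
      nlinarith [hc κ, abs_nonneg (c κ)]
    rw [hq, h1]
    linarith

/-- `|Σ_κ e_κ q_κ| ≤ Σ_κ q_κ` for signs `e` and nonnegative `q`. -/
theorem abs_signed_sum_le (e q : Fin 4 → ℝ) (he : ∀ κ, |e κ| = 1) (hq : ∀ κ, 0 ≤ q κ) :
    |∑ κ, e κ * q κ| ≤ ∑ κ, q κ := by
  calc |∑ κ, e κ * q κ| ≤ ∑ κ, |e κ * q κ| := Finset.abs_sum_le_sum_abs _ _
    _ = ∑ κ, q κ := Finset.sum_congr rfl fun κ _ => by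
        rw [abs_mul, he, one_mul, abs_of_nonneg (hq κ)]

/-- If the `μ`-signs of `e, e'` are opposite then `Σ_κ (1 − e_κ c_κ) + Σ_κ (1 − e'_κ c_κ) ≥ 2`. -/
theorem two_le_sum_add (c e e' : Fin 4 → ℝ) (μ : Fin 4) (hc : ∀ κ, |c κ| ≤ 1)
    (he : ∀ κ, |e κ| = 1) (he' : ∀ κ, |e' κ| = 1) (hμ : e' μ = -e μ) :
    2 ≤ (∑ κ, (1 - e κ * c κ)) + ∑ κ, (1 - e' κ * c κ) := by
  rw [← Finset.sum_add_distrib]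
  have hnn : ∀ κ, 0 ≤ (1 - e κ * c κ) + (1 - e' κ * c κ) := fun κ =>
    add_nonneg (term_nonneg (he κ) (hc κ)) (term_nonneg (he' κ) (hc κ))
  calc (2 : ℝ) = (1 - e μ * c μ) + (1 - e' μ * c μ) := by rw [hμ]; ring
    _ ≤ ∑ κ, ((1 - e κ * c κ) + (1 - e' κ * c κ)) :=
      Finset.single_le_sum (f := fun κ => (1 - e κ * c κ) + (1 - e' κ * c κ)) (fun i _ => hnn i)
        (Finset.mem_univ μ)

/-- There are `16` shifts `Fin 4 → ZMod 2`. -/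
theorem card_shifts : Fintype.card (Fin 4 → ZMod 2) = 16 := by
  norm_num [Fintype.card_fun, ZMod.card]

/-! ### The two core estimates (abstract real inequalities) -/

/-- Tadpole core: `|2 (u − a c) / (a² + S)| ≤ 4` when `0 ≤ u ≤ S`, `|c| ≤ 1` and
`a ≥ 1 ∨ 0 ≤ a ≤ S`. -/
theorem tad_core (a S u c : ℝ) (hu0 : 0 ≤ u) (huS : u ≤ S) (hc : |c| ≤ 1)
    (ha : 1 ≤ a ∨ (0 ≤ a ∧ a ≤ S)) : |2 * (u - a * c) / (a ^ 2 + S)| ≤ 4 := by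
  have ha0 : 0 ≤ a := by rcases ha with h | ⟨h, _⟩ <;> linarith
  have hah : a ≤ a ^ 2 + S := by
    rcases ha with h | ⟨_, h1⟩
    · nlinarith
    · linarith [sq_nonneg a]
  have hh0 : 0 ≤ a ^ 2 + S := by nlinarith [sq_nonneg a]
  have h1 : |u - a * c| ≤ 2 * (a ^ 2 + S) := by
    calc |u - a * c| ≤ |u| + |a * c| := abs_sub _ _
      _ = u + a * |c| := by rw [abs_of_nonneg hu0, abs_mul, abs_of_nonneg ha0]
      _ ≤ u + a * 1 := by gcongr
      _ ≤ 2 * (a ^ 2 + S) := by linarith [sq_nonneg a]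
  rw [abs_div, abs_of_nonneg hh0, abs_mul, abs_two]
  exact div_le_of_le_mul₀ hh0 (by norm_num) (by linarith)

/-- Bubble core: the crude three-case estimate `|T| ≤ 5 · hh · hh'`, hence
`|2 T / (hh hh')| ≤ 10`, from `u, v ≤ 1/400`, `u, v ≤ S ≤ 1/100`, `|c_μ|, |c_ν| ≤ 1`, `|W| ≤ S`,
the dichotomy for `a, a'` and `a + a' ≥ 2`. -/
theorem bub_core (a a' S u v cμ cν W d : ℝ)
    (hu0 : 0 ≤ u) (hu1 : u ≤ 1 / 400) (huS : u ≤ S)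
    (hv0 : 0 ≤ v) (hv1 : v ≤ 1 / 400) (hvS : v ≤ S) (hS1 : S ≤ 1 / 100)
    (hcμ : |cμ| ≤ 1) (hcν : |cν| ≤ 1) (hW : |W| ≤ S)
    (ha : 1 ≤ a ∨ (0 ≤ a ∧ a ≤ S)) (ha' : 1 ≤ a' ∨ (0 ≤ a' ∧ a' ≤ S)) (haa' : 2 ≤ a + a')
    (hd : d = 0 ∨ d = (-(a * a') - W) * u) :
    |2 * (a * a' * cμ * cν - W * cμ * cν + (a - a') * (cμ * v + cν * u) - 2 * u * v + d)
        / ((a ^ 2 + S) * (a' ^ 2 + S))| ≤ 10 := by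
  have ha0 : 0 ≤ a := by rcases ha with h | ⟨h, _⟩ <;> linarith
  have ha0' : 0 ≤ a' := by rcases ha' with h | ⟨h, _⟩ <;> linarith
  have hS0 : 0 ≤ S := hu0.trans huS
  have hh0 : 0 ≤ a ^ 2 + S := by positivity
  have hh0' : 0 ≤ a' ^ 2 + S := by positivity
  have hSh : S ≤ a ^ 2 + S := le_add_of_nonneg_left (sq_nonneg a)
  have hSh' : S ≤ a' ^ 2 + S := le_add_of_nonneg_left (sq_nonneg a')
  have hah : a ≤ a ^ 2 + S := by
    rcases ha with h1 | ⟨_, h1⟩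
    · nlinarith
    · linarith [sq_nonneg a]
  have hah' : a' ≤ a' ^ 2 + S := by
    rcases ha' with h1 | ⟨_, h1⟩
    · nlinarith
    · linarith [sq_nonneg a']
  set h := a ^ 2 + S with hh_def
  set h' := a' ^ 2 + S with hh'_def
  have hP0 : 0 ≤ h * h' := mul_nonneg hh0 hh0'
  -- triangle inequality: |T| ≤ R
  have hcc : |cμ * cν| ≤ 1 := by
    rw [abs_mul]
    exact mul_le_one₀ hcμ (abs_nonneg _) hcν
  have t1 : |a * a' * cμ * cν| ≤ a * a' := by
    rw [mul_assoc, abs_mul, abs_of_nonneg (mul_nonneg ha0 ha0')]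
    exact mul_le_of_le_one_right (mul_nonneg ha0 ha0') hcc
  have t2 : |W * cμ * cν| ≤ |W| := by
    rw [mul_assoc, abs_mul]
    exact mul_le_of_le_one_right (abs_nonneg _) hcc
  have t3 : |(a - a') * (cμ * v + cν * u)| ≤ (a + a') * (v + u) := by
    rw [abs_mul]
    refine mul_le_mul ?_ ?_ (abs_nonneg _) (by linarith)
    · calc |a - a'| ≤ |a| + |a'| := abs_sub _ _
        _ = a + a' := by rw [abs_of_nonneg ha0, abs_of_nonneg ha0']
    · calc |cμ * v + cν * u| ≤ |cμ * v| + |cν * u| := abs_add_le _ _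
        _ = |cμ| * v + |cν| * u := by
          rw [abs_mul, abs_mul, abs_of_nonneg hv0, abs_of_nonneg hu0]
        _ ≤ 1 * v + 1 * u := by gcongr
        _ = v + u := by ring
  have t4 : |2 * u * v| = 2 * u * v := abs_of_nonneg (by positivity)
  have t5 : |d| ≤ (a * a' + |W|) * u := by
    rcases hd with rfl | rfl
    · rw [abs_zero]
      positivity
    · rw [abs_mul, abs_of_nonneg hu0]
      refine mul_le_mul_of_nonneg_right ?_ hu0
      calc |-(a * a') - W| ≤ |-(a * a')| + |W| := abs_sub _ _
        _ = a * a' + |W| := by rw [abs_neg, abs_of_nonneg (mul_nonneg ha0 ha0')]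
  have hTri : |a * a' * cμ * cν - W * cμ * cν + (a - a') * (cμ * v + cν * u) - 2 * u * v + d|
      ≤ a * a' + |W| + (a + a') * (v + u) + 2 * u * v + (a * a' + |W|) * u := by
    have s1 := abs_sub (a * a' * cμ * cν) (W * cμ * cν)
    have s2 := abs_add_le (a * a' * cμ * cν - W * cμ * cν) ((a - a') * (cμ * v + cν * u))
    have s3 := abs_sub (a * a' * cμ * cν - W * cμ * cν + (a - a') * (cμ * v + cν * u))
      (2 * u * v)
    have s4 := abs_add_le
      (a * a' * cμ * cν - W * cμ * cν + (a - a') * (cμ * v + cν * u) - 2 * u * v) d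
    linarith
  -- the crude bound R ≤ 5 hh hh'
  have hR : a * a' + |W| + (a + a') * (v + u) + 2 * u * v + (a * a' + |W|) * u
      ≤ 5 * (h * h') := by
    have e1 : a * a' ≤ h * h' := mul_le_mul hah hah' ha0' hh0
    have e5 : (a * a' + |W|) * u ≤ (h * h' + |W|) * (1 / 400) :=
      mul_le_mul (by linarith) hu1 hu0 (by positivity)
    have e3 : (a + a') * (v + u) = a * (v + u) + a' * (v + u) := by ring
    rcases ha with ha1 | ⟨_, haS⟩ <;> rcases ha' with ha1' | ⟨_, haS'⟩
    · -- both `A`'s are `≥ 1`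
      have h1 : 1 ≤ h := ha1.trans hah
      have h1' : 1 ≤ h' := ha1'.trans hah'
      have hhP : h ≤ h * h' := le_mul_of_one_le_right hh0 h1'
      have hhP' : h' ≤ h * h' := le_mul_of_one_le_left hh0' h1
      have e2 : |W| ≤ h * h' := by linarith
      have e3a : a * (v + u) ≤ h * (1 / 200) :=
        mul_le_mul hah (by linarith) (by linarith) hh0
      have e3b : a' * (v + u) ≤ h' * (1 / 200) :=
        mul_le_mul hah' (by linarith) (by linarith) hh0'
      have e4 : u * v ≤ 1 / 400 * (1 / 400) := mul_le_mul hu1 hv1 hv0 (by norm_num)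
      linarith
    · -- `a ≥ 1`, `a' ≤ S`
      have h1 : 1 ≤ h := ha1.trans hah
      have hhP' : h' ≤ h * h' := le_mul_of_one_le_left hh0' h1
      have e2 : |W| ≤ h * h' := hW.trans (hSh'.trans hhP')
      have e3a : a * (v + u) ≤ h * (h' + h') :=
        mul_le_mul hah (add_le_add (hvS.trans hSh') (huS.trans hSh')) (by linarith) hh0
      have e3b : a' * (v + u) ≤ h' * (1 / 200) :=
        mul_le_mul (haS'.trans hSh') (by linarith) (by linarith) hh0'
      have e3c : h * (h' + h') = 2 * (h * h') := by ring
      have e4 : u * v ≤ 1 / 400 * h' := mul_le_mul hu1 (hvS.trans hSh') hv0 (by norm_num)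
      linarith
    · -- `a ≤ S`, `a' ≥ 1`
      have h1' : 1 ≤ h' := ha1'.trans hah'
      have hhP : h ≤ h * h' := le_mul_of_one_le_right hh0 h1'
      have e2 : |W| ≤ h * h' := hW.trans (hSh.trans hhP)
      have e3a : a' * (v + u) ≤ h' * (h + h) :=
        mul_le_mul hah' (add_le_add (hvS.trans hSh) (huS.trans hSh)) (by linarith) hh0'
      have e3b : a * (v + u) ≤ h * (1 / 200) :=
        mul_le_mul (haS.trans hSh) (by linarith) (by linarith) hh0
      have e3c : h' * (h + h) = 2 * (h * h') := by ring
      have e4 : u * v ≤ h * (1 / 400) := mul_le_mul (huS.trans hSh) hv1 hv0 hh0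
      linarith
    · -- both small: impossible
      exfalso
      linarith
  rw [abs_div, abs_of_nonneg hP0, abs_mul, abs_two]
  exact div_le_of_le_mul₀ hP0 (by norm_num) (by linarith)

/-! ### Assembly with opaque block functions -/

/-- The entry bound for abstract functions `C, S2, sg, A, hh, W, T` satisfying the defining
equations of the skeleton's `let`s. -/
theorem main (θ : Fin 4 → ℝ) (hθ : ∀ μ, 0 < θ μ ∧ θ μ < Real.pi)
    (hc : ∀ μ : Fin 4, min (θ μ) (Real.pi - θ μ) < 1 / 20)
    (C S2 : Fin 4 → ℝ) (sg : (Fin 4 → ZMod 2) → Fin 4 → ℝ) (A hh W : (Fin 4 → ZMod 2) → ℝ)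
    (T : (Fin 4 → ZMod 2) → (Fin 4 → ZMod 2) → Fin 4 → Fin 4 → ℝ)
    (hC : ∀ κ, C κ = Real.cos (θ κ)) (hS2 : ∀ κ, S2 κ = 1 - C κ ^ 2)
    (hsg : ∀ t κ, sg t κ = (-1 : ℝ) ^ (t κ).val)
    (hA : ∀ σ, A σ = ∑ κ, (1 - sg σ κ * C κ)) (hhh : ∀ σ, hh σ = A σ ^ 2 + ∑ κ, S2 κ)
    (hW : ∀ t, W t = ∑ κ, sg t κ * S2 κ)
    (hT : ∀ σ s μ ν, T σ s μ ν = A σ * A (σ + s) * (sg σ μ * C μ) * (sg σ ν * C ν)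
      - W s * (sg σ μ * C μ) * (sg σ ν * C ν)
      + (A σ - A (σ + s)) * (sg σ μ * C μ * S2 ν + sg σ ν * C ν * S2 μ) - 2 * S2 μ * S2 ν
      + (if μ = ν then (-(A σ * A (σ + s)) - W s) * S2 μ else 0))
    (s : Fin 4 → ZMod 2) (μ ν : Fin 4) (hsμ : s μ = 1) :
    |(if μ = ν then ∑ σ, 2 * (S2 μ - A σ * (sg σ μ * C μ)) / hh σ else 0)
      + ∑ σ, 2 * T σ s μ ν / (hh σ * hh (σ + s))| ≤ 256 := by
  -- basic facts about the block functions
  have hS2b : ∀ κ, 0 ≤ S2 κ ∧ S2 κ ≤ 1 / 400 := fun κ => by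
    rw [hS2, hC]
    exact sin_sq_le (θ κ) (hθ κ).1 (hθ κ).2 (hc κ)
  have hSum : ∑ κ, S2 κ ≤ 1 / 100 :=
    calc ∑ κ, S2 κ ≤ ∑ _κ : Fin 4, (1 / 400 : ℝ) := Finset.sum_le_sum fun κ _ => (hS2b κ).2
      _ = 1 / 100 := by rw [Finset.sum_const, Finset.card_univ, Fintype.card_fin]; norm_num
  have hS2le : ∀ κ, S2 κ ≤ ∑ κ, S2 κ := fun κ =>
    Finset.single_le_sum (f := S2) (fun i _ => (hS2b i).1) (Finset.mem_univ κ)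
  have hsgabs : ∀ t κ, |sg t κ| = 1 := fun t κ => by
    rw [hsg]
    exact abs_neg_one_pow _
  have hCabs : ∀ κ, |C κ| ≤ 1 := fun κ => by
    rw [hC]
    exact Real.abs_cos_le_one _
  have hcb : ∀ t κ, |sg t κ * C κ| ≤ 1 := fun t κ => by
    rw [abs_mul, hsgabs, one_mul]
    exact hCabs κ
  have hWabs : ∀ t, |W t| ≤ ∑ κ, S2 κ := fun t => by
    rw [hW]
    exact abs_signed_sum_le (sg t) S2 (hsgabs t) fun κ => (hS2b κ).1
  have hdich : ∀ σ, 1 ≤ A σ ∨ (0 ≤ A σ ∧ A σ ≤ ∑ κ, S2 κ) := fun σ => by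
    rw [hA]
    exact dichotomy C (sg σ) S2 hCabs (hsgabs σ) hS2
  have htwo : ∀ σ, 2 ≤ A σ + A (σ + s) := fun σ => by
    rw [hA, hA]
    refine two_le_sum_add C (sg σ) (sg (σ + s)) μ hCabs (hsgabs σ) (hsgabs (σ + s)) ?_
    rw [hsg, hsg, Pi.add_apply, hsμ]
    exact neg_one_pow_val_add_one (σ μ)
  -- per-shift bounds
  have htad : ∀ σ, |2 * (S2 μ - A σ * (sg σ μ * C μ)) / hh σ| ≤ 4 := fun σ => by
    rw [hhh]
    exact tad_core (A σ) (∑ κ, S2 κ) (S2 μ) (sg σ μ * C μ) (hS2b μ).1 (hS2le μ) (hcb σ μ)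
      (hdich σ)
  have hbub : ∀ σ, |2 * T σ s μ ν / (hh σ * hh (σ + s))| ≤ 10 := fun σ => by
    rw [hT, hhh, hhh]
    refine bub_core (A σ) (A (σ + s)) (∑ κ, S2 κ) (S2 μ) (S2 ν) (sg σ μ * C μ) (sg σ ν * C ν)
      (W s) _ (hS2b μ).1 (hS2b μ).2 (hS2le μ) (hS2b ν).1 (hS2b ν).2 (hS2le ν) hSum (hcb σ μ)
      (hcb σ ν) (hWabs s) (hdich σ) (hdich (σ + s)) (htwo σ) ?_
    by_cases hμν : μ = ν
    · exact Or.inr (if_pos hμν)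
    · exact Or.inl (if_neg hμν)
  -- summation over the 16 shifts
  have hsum_tad : |∑ σ, 2 * (S2 μ - A σ * (sg σ μ * C μ)) / hh σ| ≤ 64 :=
    calc |∑ σ, 2 * (S2 μ - A σ * (sg σ μ * C μ)) / hh σ|
        ≤ ∑ σ, |2 * (S2 μ - A σ * (sg σ μ * C μ)) / hh σ| := Finset.abs_sum_le_sum_abs _ _
      _ ≤ ∑ _σ : Fin 4 → ZMod 2, (4 : ℝ) := Finset.sum_le_sum fun σ _ => htad σ
      _ = 64 := by rw [Finset.sum_const, Finset.card_univ, card_shifts]; norm_num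
  have hsum_bub : |∑ σ, 2 * T σ s μ ν / (hh σ * hh (σ + s))| ≤ 160 :=
    calc |∑ σ, 2 * T σ s μ ν / (hh σ * hh (σ + s))|
        ≤ ∑ σ, |2 * T σ s μ ν / (hh σ * hh (σ + s))| := Finset.abs_sum_le_sum_abs _ _
      _ ≤ ∑ _σ : Fin 4 → ZMod 2, (10 : ℝ) := Finset.sum_le_sum fun σ _ => hbub σ
      _ = 160 := by rw [Finset.sum_const, Finset.card_univ, card_shifts]; norm_num
  have hif : |(if μ = ν then ∑ σ, 2 * (S2 μ - A σ * (sg σ μ * C μ)) / hh σ else 0)| ≤ 64 := by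
    split_ifs
    · exact hsum_tad
    · rw [abs_zero]
      norm_num
  calc |(if μ = ν then ∑ σ, 2 * (S2 μ - A σ * (sg σ μ * C μ)) / hh σ else 0)
          + ∑ σ, 2 * T σ s μ ν / (hh σ * hh (σ + s))|
      ≤ |(if μ = ν then ∑ σ, 2 * (S2 μ - A σ * (sg σ μ * C μ)) / hh σ else 0)|
          + |∑ σ, 2 * T σ s μ ν / (hh σ * hh (σ + s))| := abs_add_le _ _
    _ ≤ 64 + 160 := add_le_add hif hsum_bub
    _ ≤ 256 := by norm_num

end CornerEntry

/-- **Stub CB — `stub_cornerEntryBound`** (crude entry bound of the closed-form block Hessian on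
the corner box).  For `θ ∈ (0,π)⁴` with `min (θ_μ, π − θ_μ) < 1/20` for all `μ`, every entry
`Hc s μ ν` of the closed-form block Hessian with `s μ = s ν = 1` satisfies `|Hc s μ ν| ≤ 256`.
Proof: name the `let`s and apply `CornerEntry.main`. -/
theorem stub_cornerEntryBound : ∀ (θ : Fin 4 → ℝ), (∀ μ, 0 < θ μ ∧ θ μ < Real.pi) → (∀ μ : Fin 4, min (θ μ) (Real.pi - θ μ) < 1 / 20) → let C : Fin 4 → ℝ := fun κ => Real.cos (θ κ); let S2 : Fin 4 → ℝ := fun κ => 1 - C κ ^ 2; let sg : (Fin 4 → ZMod 2) → Fin 4 → ℝ := fun t κ => (-1 : ℝ) ^ (t κ).val; let A : (Fin 4 → ZMod 2) → ℝ := fun σ => ∑ κ : Fin 4, (1 - sg σ κ * C κ); let hh : (Fin 4 → ZMod 2) → ℝ := fun σ => A σ ^ 2 + ∑ κ : Fin 4, S2 κ; let W : (Fin 4 → ZMod 2) → ℝ := fun s => ∑ κ : Fin 4, sg s κ * S2 κ; let T : (Fin 4 → ZMod 2) → (Fin 4 → ZMod 2) → Fin 4 → Fin 4 → ℝ := fun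 σ s μ ν => A σ * A (σ + s) * (sg σ μ * C μ) * (sg σ ν * C ν) - W s * (sg σ μ * C μ) * (sg σ ν * C ν) + (A σ - A (σ + s)) * (sg σ μ * C μ * S2 ν + sg σ ν * C ν * S2 μ) - 2 * S2 μ * S2 ν + (if μ = ν then (-(A σ * A (σ + s)) - W s) * S2 μ else 0); let Hc : (Fin 4 → ZMod 2) → Fin 4 → Fin 4 → ℝ := fun s μ ν => (if μ = ν then ∑ σ : Fin 4 → ZMod 2, 2 * (S2 μ - A σ * (sg σ μ * C μ)) / hh σ else 0) + ∑ σ : Fin 4 → ZMod 2, 2 * T σ s μ ν / (hh σ * hh (σ + s)); ∀ (s : Fin 4 → ZMod 2) (μ ν : Fin 4), s μ = 1 → s ν = 1 → |Hc s μ ν| ≤ 256 := by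
  intro θ hθ hc C S2 sg A hh W T Hc s μ ν hsμ _
  exact CornerEntry.main θ hθ hc C S2 sg A hh W T (fun _ => rfl) (fun _ => rfl) (fun _ _ => rfl)
    (fun _ => rfl) (fun _ => rfl) (fun _ => rfl) (fun _ _ _ _ => rfl) s μ ν hsμ

end Summit.QuantumFields.QCD.Cruxes.CriticalLineDiamagnetism.ChessboardCellGain
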